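import Literature.NumberTheory.ComplexMultiplication.PairFlipSexticReflexSlotCube
import HarnessLib

/-!
# The TWIN of the reflex slot: the other CM quadratic extension of the maximal real subfield of the reflex field

COR-CM (cell `pub-hodgecm2`, binder seat `b16` gen 45, count-neutral claim REFLEX-OCTIC-34 part II, file T2); theorems
only, no definition, no named fact, no `sorry`.  Setting of `PairFlipSexticReflexSlotCube` (the pair-flip slot `Z`,
`Φ₀ = {x₁, x₂, x₃}`, flips `φ₁, φ₂, φ₃`; its reflex slot `Y`, `T : Y → Set Z`, `T(y₀) = Φ₀`, the cube) enriched by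

* a PURE TRANSPOSITION `t ∈ G` of `x₁, x₂` fixing `x₃` (available when the image of `G` in the signed permutations
  of `Z` is the full hyperoctahedral group `ℤ₂ ≀ 𝔖₃`, i.e. a sextic CM field with Galois closure of degree `48`);
* a `G`-set `X` with an equivariant `qM : Y → X` constant on antipodal pairs and onto (the embeddings of the maximal
  real subfield `M` of the reflex field `K*`: `X = Y/ρ`, the four body diagonals of the cube);
* a `G`-set `X_k = {κ₀, ρκ₀}` on which `G` acts through its action on `Z`, with `ρκ₀ ≠ κ₀` and `tκ₀ ≠ κ₀` (the two
  embeddings of an imaginary quadratic field `k ⊂ L_T` NOT contained in `K*` — in `ℤ₂ × 𝔖₄` the fixed field of the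
  rotation subgroup `𝔖₄`, on which sign changes and transpositions act by `−1`);
* the TWIN SLOT `Y'` with equivariant `πM : Y' → X` (fibres the antipodal pairs `{y', ρy'}`) and `πk : Y' → X_k`
  (the embeddings of the octic CM field `K' = M·k`, the OTHER CM quadratic extension of `M` inside `L_T`:
  `Hom(K', ℂ) ≅ X_k × X`).

Results (the combinatorics behind `ReflexTwinSlotRank`):
* §1 `smul_base_iff_of_two` &c. — bookkeeping on the two-point set `X_k`; `pairFlip_smul_base_ne` — every pair flip
  moves `κ₀` (else all flips, hence `ρ = φ₁φ₂φ₃`, would fix it); so `g₄ = tφ₂` and `h = tφ₃` FIX `κ₀`.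
* §2 the cube: `g₄y₀ = φ₁y₀`, `g₄²y₀ = ρφ₃y₀`, `g₄³y₀ = φ₂y₀` (`g₄` is the `90°` rotation about the third axis: a
  `4`-cycle on the diagonals), `h(φ₂y₀) = ρ(φ₂y₀)` (`h`, a half-turn about an edge axis, fixes the diagonal of `φ₂y₀`);
  hence `exists_pow_smul_of_twin` — every point of `Y'` is `g₄^k y₁'` or `ρ g₄^k y₁'` (`k < 4`) for a base point `y₁'`
  over `qM(y₀)` — and `smul_eq_self_of_twin` — `h` FIXES the points of `Y'` over `qM(φ₂y₀)`.
* §3 **`eq_zero_of_odd_of_twin`** — an odd weight `f` on `Y'` with `f∘g₄ = f` and `f∘h = −f` vanishes.  (In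
  `ReflexTwinSlotRank`: `Anti(Z) ∋ e₃ = δ_{x₃} − δ_{ρx₃}` has `e₃∘g₄ = e₃`, `e₃∘h = −e₃`, so there is no non-zero
  equivariant map between `Anti(Z) ≅ det ⊗ (std ⊗ sgn)` and `Anti(Y') ≅ det ⊗ (1 ⊕ std)`: the pair `(Φ₀, Ψ')` has no
  common constituent and its rank is ADDITIVE for every type `Ψ'` of the twin slot.)

## References

* [Dodson1984] B. Dodson, *The structure of Galois groups of CM-fields*, Trans. AMS 283 (1984), §5.1.2, Prop. 5.2.2
  (the degree-`8` structures inside `ℤ₂ × 𝔖₄`), §3.3.2.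
* [Shimura1998] G. Shimura, *Abelian Varieties with Complex Multiplication and Modular Functions*, §8.3–8.4.

Provenance: Literature home (namespace `Literature.NumberTheory.ComplexMultiplication`) of the Summits-side `CorCM/ReflexTwinSlot` (cell `pub-hodgecm2`, COR-CM; all its imports are `Literature/`, Mathlib and the already re-homed `PairFlipSexticReflexSlotCube`), which `Literature/` may not import; theorems only, no named fact, no definition. Nothing here bears on `HC_CM`. Lane `lit-hodgefound` (Layer A3: CM types, their Kubota ranks and Galois combinatorics), seat p20.
-/

set_option autoImplicit false

open scoped BigOperators Classical

namespace Literature.NumberTheory.ComplexMultiplication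

namespace ReflexSlot

open Literature.NumberTheory.ComplexMultiplication

variable {G : Type*} [Group G] {Z Y Y' X Xk : Type*} [MulAction G Z] [MulAction G Y] [MulAction G Y']
  [MulAction G X] [MulAction G Xk] {ρ : G} {Φ₀ : Set Z} {T : Y → Set Z} {y₀ : Y} {x₁ x₂ x₃ : Z}
  {φ₁ φ₂ φ₃ t : G} {qM : Y → X} {πM : Y' → X} {πk : Y' → Xk} {κ₀ : Xk}

/-! ### §1 The two-point set `X_k` -/

/-- On `X_k = {κ₀, ρκ₀}` (action through `Z`): `ρρκ₀ = κ₀` and `gρκ₀ = ρgκ₀`. [cite: Dodson1984, §5.1.2] -/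
theorem rho_smul_base (hΦ : IsCMTypeWith ρ Φ₀)
    (hfac : ∀ g g' : G, (∀ z : Z, g • z = g' • z) → ∀ κ : Xk, g • κ = g' • κ) (g : G) :
    ρ • ρ • κ₀ = κ₀ ∧ g • ρ • κ₀ = ρ • g • κ₀ := by
  constructor
  · rw [← mul_smul]
    have h1 := hfac (ρ * ρ) 1 (fun z => by rw [mul_smul, hΦ.invol, one_smul]) κ₀
    rwa [one_smul] at h1
  · rw [← mul_smul, ← mul_smul]
    exact hfac _ _ (fun z => by rw [mul_smul, mul_smul, hΦ.comm]) κ₀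

/-- An element either fixes `κ₀` or maps it to `ρκ₀`. [cite: Dodson1984, §5.1.2] -/
theorem smul_base_eq_rho_of_ne (hXk : ∀ κ : Xk, κ = κ₀ ∨ κ = ρ • κ₀) {g : G} (hg : g • κ₀ ≠ κ₀) :
    g • κ₀ = ρ • κ₀ :=
  (hXk (g • κ₀)).resolve_left hg

/-- **Product rule on the two-point set**: `(gg')κ₀ = κ₀ ⟺ (gκ₀ = κ₀ ⟺ g'κ₀ = κ₀)`. [cite: Dodson1984, §5.1.2] -/
theorem mul_smul_base_eq_iff (hΦ : IsCMTypeWith ρ Φ₀)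
    (hfac : ∀ g g' : G, (∀ z : Z, g • z = g' • z) → ∀ κ : Xk, g • κ = g' • κ)
    (hXk : ∀ κ : Xk, κ = κ₀ ∨ κ = ρ • κ₀) (hκ : ρ • κ₀ ≠ κ₀) (g g' : G) :
    (g * g') • κ₀ = κ₀ ↔ (g • κ₀ = κ₀ ↔ g' • κ₀ = κ₀) := by
  obtain ⟨hρρ, -⟩ := rho_smul_base hΦ hfac g
  have hcomm := fun g => (rho_smul_base (κ₀ := κ₀) hΦ hfac g).2
  rw [mul_smul]
  rcases hXk (g' • κ₀) with h' | h'
  · rw [h']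
    exact ⟨fun h => ⟨fun _ => rfl, fun _ => h⟩, fun h => h.2 rfl⟩
  · rw [h', hcomm]
    constructor
    · intro h1
      refine ⟨fun h2 => ?_, fun h3 => absurd h3 hκ⟩
      rw [h2] at h1
      exact absurd h1 hκ
    · intro h1
      have h2 : g • κ₀ ≠ κ₀ := fun h2 => hκ (h1.1 h2)
      rw [smul_base_eq_rho_of_ne hXk h2, hρρ]

/-- Elements of `G` agreeing on `Φ₀` agree on `κ₀`. [cite: Dodson1984, §5.1.2] -/
theorem smul_base_eq_of_forall_mem (hΦ : IsCMTypeWith ρ Φ₀)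
    (hfac : ∀ g g' : G, (∀ z : Z, g • z = g' • z) → ∀ κ : Xk, g • κ = g' • κ) {g g' : G}
    (h : ∀ x ∈ Φ₀, g • x = g' • x) : g • κ₀ = g' • κ₀ :=
  hfac g g' (forall_smul_eq_of_forall_mem hΦ h) κ₀

/-- **Every pair flip moves `κ₀`.**  If the flip `φ₃` fixed `κ₀`, so would every flip `cφ₃c⁻¹` at `cx₃` — hence
`φ₁, φ₂` (transitivity) and `ρ = φ₁φ₂φ₃` on `Z` — contradicting `ρκ₀ ≠ κ₀`. [cite: Dodson1984, §5.1.2] -/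
theorem pairFlip_smul_base_ne [MulAction.IsPretransitive G Z] (hΦ : IsCMTypeWith ρ Φ₀)
    (hfac : ∀ g g' : G, (∀ z : Z, g • z = g' • z) → ∀ κ : Xk, g • κ = g' • κ)
    (hXk : ∀ κ : Xk, κ = κ₀ ∨ κ = ρ • κ₀) (hκ : ρ • κ₀ ≠ κ₀) (hx : Φ₀ = {x₁, x₂, x₃}) (h12 : x₁ ≠ x₂)
    (h13 : x₁ ≠ x₃) (h23 : x₂ ≠ x₃)
    (hφ₁ : φ₁ • x₁ = ρ • x₁ ∧ ∀ z : Z, z ≠ x₁ → z ≠ ρ • x₁ → φ₁ • z = z)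
    (hφ₂ : φ₂ • x₂ = ρ • x₂ ∧ ∀ z : Z, z ≠ x₂ → z ≠ ρ • x₂ → φ₂ • z = z)
    (hφ₃ : φ₃ • x₃ = ρ • x₃ ∧ ∀ z : Z, z ≠ x₃ → z ≠ ρ • x₃ → φ₃ • z = z) :
    φ₃ • κ₀ ≠ κ₀ := by
  obtain ⟨m₁, m₂, m₃⟩ := mem_of_eq_triple hx
  intro h3
  -- a flip at `x` conjugate to `φ₃` fixes `κ₀`
  have key : ∀ {x : Z} {φ : G}, x ∈ Φ₀ → (φ • x = ρ • x ∧ ∀ z : Z, z ≠ x → z ≠ ρ • x → φ • z = z) →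
      φ • κ₀ = κ₀ := by
    intro x φ hxm hφ
    obtain ⟨c, hc⟩ := MulAction.exists_smul_eq G x₃ x
    -- `cφ₃c⁻¹` is a flip at `x`
    have hconj : ∀ z : Z, (c * φ₃ * c⁻¹) • z = φ • z := by
      refine pairFlip_smul_eq_pairFlip_smul' hΦ ?_ hφ
      refine ⟨by rw [mul_smul, mul_smul, inv_smul_eq_iff.2 hc.symm, hφ₃.1, hΦ.comm, hc], fun w hw hw' => ?_⟩
      rw [mul_smul, mul_smul, hφ₃.2 (c⁻¹ • w) (fun h' => hw ?_) (fun h' => hw' ?_), smul_inv_smul]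
      · rw [← hc, ← h', smul_inv_smul]
      · rw [← hc, ← hΦ.comm, ← h', smul_inv_smul]
    rw [← hfac _ _ hconj κ₀, mul_smul, mul_smul]
    rcases hXk (c⁻¹ • κ₀) with h' | h'
    · have hc' : c • κ₀ = κ₀ := by conv_lhs => rw [← h']; rw [smul_inv_smul]
      rw [h', h3, hc']
    · rw [h', (rho_smul_base hΦ hfac φ₃).2, h3, ← h', smul_inv_smul]
  have k₁ := key m₁ hφ₁
  have k₂ := key m₂ hφ₂
  -- then `ρ = φ₁φ₂φ₃` fixes `κ₀`
  have hρ : ρ • κ₀ = (φ₁ * φ₂ * φ₃) • κ₀ := by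
    refine smul_base_eq_of_forall_mem hΦ hfac (forall_mem_of_triple hx ?_ ?_ ?_)
    · rw [mul_smul, mul_smul, (pairFlip_smul_eq_of_mem hΦ m₃ m₁ h13 hφ₃.2).1,
        (pairFlip_smul_eq_of_mem hΦ m₂ m₁ h12 hφ₂.2).1, hφ₁.1]
    · rw [mul_smul, mul_smul, (pairFlip_smul_eq_of_mem hΦ m₃ m₂ h23 hφ₃.2).1, hφ₂.1,
        (pairFlip_smul_eq_of_mem hΦ m₁ m₂ h12.symm hφ₁.2).2]
    · rw [mul_smul, mul_smul, hφ₃.1, (pairFlip_smul_eq_of_mem hΦ m₂ m₃ h23.symm hφ₂.2).2,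
        (pairFlip_smul_eq_of_mem hΦ m₁ m₃ h13.symm hφ₁.2).2]
  rw [hρ, mul_smul, mul_smul, h3, k₂, k₁] at hκ
  exact hκ rfl
where
  /-- Two pair flips at the same point act alike (local copy for `Z`). [cite: Dodson1984, §5.1] -/
  pairFlip_smul_eq_pairFlip_smul' (hΦ : IsCMTypeWith ρ Φ₀) {σ φ : G} {x : Z}
      (hσ : σ • x = ρ • x ∧ ∀ w : Z, w ≠ x → w ≠ ρ • x → σ • w = w)
      (hφ : φ • x = ρ • x ∧ ∀ w : Z, w ≠ x → w ≠ ρ • x → φ • w = w) : ∀ z : Z, σ • z = φ • z := fun z => by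
    by_cases hz : z = x
    · rw [hz, hσ.1, hφ.1]
    · by_cases hz' : z = ρ • x
      · rw [hz', hΦ.comm σ x, hσ.1, hΦ.comm φ x, hφ.1]
      · rw [hσ.2 z hz hz', hφ.2 z hz hz']

/-- **`g₄ = tφ₂` and `h = tφ₃` fix `κ₀`** (each is a product of two elements moving `κ₀`).
[cite: Dodson1984, §5.1.2] -/
theorem twist_smul_base_eq [MulAction.IsPretransitive G Z] (hΦ : IsCMTypeWith ρ Φ₀)
    (hfac : ∀ g g' : G, (∀ z : Z, g • z = g' • z) → ∀ κ : Xk, g • κ = g' • κ)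
    (hXk : ∀ κ : Xk, κ = κ₀ ∨ κ = ρ • κ₀) (hκ : ρ • κ₀ ≠ κ₀) (hx : Φ₀ = {x₁, x₂, x₃}) (h12 : x₁ ≠ x₂)
    (h13 : x₁ ≠ x₃) (h23 : x₂ ≠ x₃)
    (hφ₁ : φ₁ • x₁ = ρ • x₁ ∧ ∀ z : Z, z ≠ x₁ → z ≠ ρ • x₁ → φ₁ • z = z)
    (hφ₂ : φ₂ • x₂ = ρ • x₂ ∧ ∀ z : Z, z ≠ x₂ → z ≠ ρ • x₂ → φ₂ • z = z)
    (hφ₃ : φ₃ • x₃ = ρ • x₃ ∧ ∀ z : Z, z ≠ x₃ → z ≠ ρ • x₃ → φ₃ • z = z) (htκ : t • κ₀ ≠ κ₀) :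
    (t * φ₂) • κ₀ = κ₀ ∧ (t * φ₃) • κ₀ = κ₀ := by
  have hx₃ : Φ₀ = {x₁, x₃, x₂} := by rw [hx, Set.pair_comm x₂ x₃]
  have n₂ := pairFlip_smul_base_ne hΦ hfac hXk hκ hx₃ h13 h12 h23.symm hφ₁ hφ₃ hφ₂
  have n₃ := pairFlip_smul_base_ne hΦ hfac hXk hκ hx h12 h13 h23 hφ₁ hφ₂ hφ₃
  exact ⟨(mul_smul_base_eq_iff hΦ hfac hXk hκ t φ₂).2 ⟨fun h => absurd h htκ, fun h => absurd h n₂⟩,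
    (mul_smul_base_eq_iff hΦ hfac hXk hκ t φ₃).2 ⟨fun h => absurd h htκ, fun h => absurd h n₃⟩⟩

/-! ### §2 The cube under `g₄ = tφ₂` and `h = tφ₃` -/

section Cube

/-- **`g₄y₀ = φ₁y₀`, `g₄(φ₃y₀) = ρφ₂y₀`, `h(φ₂y₀) = ρφ₂y₀`** for `g₄ = tφ₂`, `h = tφ₃` (coordinates on the cube).
[cite: Dodson1984, §5.1.2] -/
theorem twist_smul_cube (hΦ : IsCMTypeWith ρ Φ₀)
    (hT : ∀ (g : G) (y : Y) (x : Z), x ∈ T (g • y) ↔ g⁻¹ • x ∈ T y) (hTi : Function.Injective T)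
    (hT₀ : T y₀ = Φ₀) (hY : ∀ y : Y, ∃ g : G, g • y₀ = y) (hx : Φ₀ = {x₁, x₂, x₃}) (h12 : x₁ ≠ x₂)
    (h13 : x₁ ≠ x₃) (h23 : x₂ ≠ x₃)
    (hφ₁ : φ₁ • x₁ = ρ • x₁ ∧ ∀ z : Z, z ≠ x₁ → z ≠ ρ • x₁ → φ₁ • z = z)
    (hφ₂ : φ₂ • x₂ = ρ • x₂ ∧ ∀ z : Z, z ≠ x₂ → z ≠ ρ • x₂ → φ₂ • z = z)
    (hφ₃ : φ₃ • x₃ = ρ • x₃ ∧ ∀ z : Z, z ≠ x₃ → z ≠ ρ • x₃ → φ₃ • z = z)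
    (ht : t • x₁ = x₂ ∧ t • x₂ = x₁ ∧ t • x₃ = x₃) :
    (t * φ₂) • y₀ = φ₁ • y₀ ∧ (t * φ₂) • φ₃ • y₀ = ρ • φ₂ • y₀ ∧ (t * φ₃) • φ₂ • y₀ = ρ • φ₂ • y₀ := by
  obtain ⟨m₁, m₂, m₃⟩ := mem_of_eq_triple hx
  obtain ⟨t₁, t₂, t₃⟩ := ht
  have b₁ : x₁ ∈ T y₀ := by rw [hT₀]; exact m₁
  have b₂ : x₂ ∈ T y₀ := by rw [hT₀]; exact m₂
  have b₃ : x₃ ∈ T y₀ := by rw [hT₀]; exact m₃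
  have hx₂ : Φ₀ = {x₂, x₁, x₃} := by rw [hx, Set.insert_comm]
  have hx₃ : Φ₀ = {x₁, x₃, x₂} := by rw [hx, Set.pair_comm x₂ x₃]
  have c₁ := mem_typeMap_pairFlip_smul hΦ hT hT₀ hY hx₂ h12.symm h13 hφ₁
  have c₂ := mem_typeMap_pairFlip_smul hΦ hT hT₀ hY hx h12 h23 hφ₂
  have c₃ := mem_typeMap_pairFlip_smul hΦ hT hT₀ hY hx₃ h13 h23.symm hφ₃
  have nρ := fun (y : Y) (x : Z) => mem_typeMap_rho_smul_iff hΦ hT hT₀ hY y x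
  -- inverse images of the three points under `tφ₂` and `tφ₃`
  have i₁ : (t * φ₂)⁻¹ • x₁ = ρ • x₂ := by
    rw [inv_smul_eq_iff, mul_smul, smul_rho_eq_of_pairFlip hΦ hφ₂.1, t₂]
  have i₂ : (t * φ₂)⁻¹ • x₂ = x₁ := by
    rw [inv_smul_eq_iff, mul_smul, (pairFlip_smul_eq_of_mem hΦ m₂ m₁ h12 hφ₂.2).1, t₁]
  have i₃ : (t * φ₂)⁻¹ • x₃ = x₃ := by
    rw [inv_smul_eq_iff, mul_smul, (pairFlip_smul_eq_of_mem hΦ m₂ m₃ h23.symm hφ₂.2).1, t₃]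
  have j₁ : (t * φ₃)⁻¹ • x₁ = x₂ := by
    rw [inv_smul_eq_iff, mul_smul, (pairFlip_smul_eq_of_mem hΦ m₃ m₂ h23 hφ₃.2).1, t₂]
  have j₂ : (t * φ₃)⁻¹ • x₂ = x₁ := by
    rw [inv_smul_eq_iff, mul_smul, (pairFlip_smul_eq_of_mem hΦ m₃ m₁ h13 hφ₃.2).1, t₁]
  have j₃ : (t * φ₃)⁻¹ • x₃ = ρ • x₃ := by
    rw [inv_smul_eq_iff, mul_smul, smul_rho_eq_of_pairFlip hΦ hφ₃.1, t₃]
  have nb₂ : ρ • x₂ ∉ T y₀ := fun h => (rho_smul_mem_typeMap_iff hΦ hT hT₀ hY y₀ x₂).1 h b₂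
  refine ⟨?_, ?_, ?_⟩
  · refine eq_of_forall_mem_typeMap_iff hΦ hT hTi hT₀ hY (forall_mem_of_triple hx ?_ ?_ ?_)
    · rw [hT, i₁, (c₁ y₀).2.1]; exact ⟨fun h => absurd h nb₂, fun h => absurd b₁ h⟩
    · rw [hT, i₂, (c₁ y₀).1]; exact ⟨fun _ => b₂, fun _ => b₁⟩
    · rw [hT, i₃, (c₁ y₀).2.2]
  · refine eq_of_forall_mem_typeMap_iff hΦ hT hTi hT₀ hY (forall_mem_of_triple hx ?_ ?_ ?_)
    · rw [hT, i₁, nρ, (c₂ y₀).1, (rho_smul_mem_typeMap_iff hΦ hT hT₀ hY), (c₃ y₀).2.2]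
      exact ⟨fun h => absurd b₂ h, fun h => absurd b₁ h⟩
    · rw [hT, i₂, nρ, (c₂ y₀).2.1, (c₃ y₀).1, not_not]
      exact ⟨fun _ => b₂, fun _ => b₁⟩
    · rw [hT, i₃, nρ, (c₂ y₀).2.2, (c₃ y₀).2.1]
  · refine eq_of_forall_mem_typeMap_iff hΦ hT hTi hT₀ hY (forall_mem_of_triple hx ?_ ?_ ?_)
    · rw [hT, j₁, nρ, (c₂ y₀).1, (c₂ y₀).2.1]
      exact ⟨fun h => absurd b₂ h, fun h => absurd b₁ h⟩
    · rw [hT, j₂, nρ, (c₂ y₀).2.1, (c₂ y₀).1, not_not]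
      exact ⟨fun _ => b₂, fun _ => b₁⟩
    · rw [hT, j₃, rho_smul_mem_typeMap_iff hΦ hT hT₀ hY, nρ, (c₂ y₀).2.2]

/-- **`g₄² y₀ = ρφ₃y₀` and `g₄³y₀ = φ₂y₀`** (`g₄ = tφ₂` is a `4`-cycle on the diagonals). [cite: Dodson1984, §5.1.2] -/
theorem twist_pow_smul_cube (hΦ : IsCMTypeWith ρ Φ₀)
    (hT : ∀ (g : G) (y : Y) (x : Z), x ∈ T (g • y) ↔ g⁻¹ • x ∈ T y) (hTi : Function.Injective T)
    (hT₀ : T y₀ = Φ₀) (hY : ∀ y : Y, ∃ g : G, g • y₀ = y) (hx : Φ₀ = {x₁, x₂, x₃}) (h12 : x₁ ≠ x₂)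
    (h13 : x₁ ≠ x₃) (h23 : x₂ ≠ x₃)
    (hφ₁ : φ₁ • x₁ = ρ • x₁ ∧ ∀ z : Z, z ≠ x₁ → z ≠ ρ • x₁ → φ₁ • z = z)
    (hφ₂ : φ₂ • x₂ = ρ • x₂ ∧ ∀ z : Z, z ≠ x₂ → z ≠ ρ • x₂ → φ₂ • z = z)
    (hφ₃ : φ₃ • x₃ = ρ • x₃ ∧ ∀ z : Z, z ≠ x₃ → z ≠ ρ • x₃ → φ₃ • z = z)
    (ht : t • x₁ = x₂ ∧ t • x₂ = x₁ ∧ t • x₃ = x₃) :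
    (t * φ₂) ^ 2 • y₀ = ρ • φ₃ • y₀ ∧ (t * φ₂) ^ 3 • y₀ = φ₂ • y₀ := by
  obtain ⟨c1, c2, -⟩ := twist_smul_cube hΦ hT hTi hT₀ hY hx h12 h13 h23 hφ₁ hφ₂ hφ₃ ht
  have comm := smul_rho_smul_comm hΦ hT hTi
  obtain ⟨m₁, m₂, m₃⟩ := mem_of_eq_triple hx
  obtain ⟨t₁, t₂, t₃⟩ := ht
  have f21 := (pairFlip_smul_eq_of_mem hΦ m₂ m₁ h12 hφ₂.2)
  have f23 := (pairFlip_smul_eq_of_mem hΦ m₂ m₃ h23.symm hφ₂.2)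
  have f12 := (pairFlip_smul_eq_of_mem hΦ m₁ m₂ h12.symm hφ₁.2)
  have f13 := (pairFlip_smul_eq_of_mem hΦ m₁ m₃ h13.symm hφ₁.2)
  have hZ : ∀ z : Z, ((t * φ₂) ^ 2) • z = (φ₁ * φ₂) • z :=
    forall_smul_eq_of_forall_mem hΦ (forall_mem_of_triple hx
      (by rw [pow_two, mul_smul, mul_smul, mul_smul, f21.1, t₁, hφ₂.1, hΦ.comm, t₂, mul_smul, f21.1, hφ₁.1])
      (by rw [pow_two, mul_smul, mul_smul, mul_smul, hφ₂.1, hΦ.comm, t₂, f21.2, hΦ.comm, t₁, mul_smul, hφ₂.1,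
        f12.2])
      (by rw [pow_two, mul_smul, mul_smul, mul_smul, f23.1, t₃, f23.1, t₃, mul_smul, f23.1, f13.1]))
  have sq : (t * φ₂) ^ 2 • y₀ = ρ • φ₃ • y₀ := by
    rw [smul_eq_smul_of_forall_smul_eq hT hTi hZ y₀, mul_smul,
      ← rho_smul_pairFlip_smul_pairFlip_smul hΦ hT hTi hx h12 h13 h23 hφ₁ hφ₂ hφ₃ y₀, rho_smul_rho_smul hΦ hT hTi]
  refine ⟨sq, ?_⟩
  rw [pow_succ', mul_smul, sq, comm, c2, rho_smul_rho_smul hΦ hT hTi]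

/-- **Every point of `X = Y/ρ` is `qM(g₄^k y₀)` for some `k < 4`** (`g₄ = tφ₂` is a `4`-cycle on the four
diagonals of the cube). [cite: Dodson1984, §5.1.2] -/
theorem exists_pow_qM_eq [Fintype Y] (hΦ : IsCMTypeWith ρ Φ₀)
    (hT : ∀ (g : G) (y : Y) (x : Z), x ∈ T (g • y) ↔ g⁻¹ • x ∈ T y) (hTi : Function.Injective T)
    (hT₀ : T y₀ = Φ₀) (hY : ∀ y : Y, ∃ g : G, g • y₀ = y) (hx : Φ₀ = {x₁, x₂, x₃}) (h12 : x₁ ≠ x₂)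
    (h13 : x₁ ≠ x₃) (h23 : x₂ ≠ x₃)
    (hφ₁ : φ₁ • x₁ = ρ • x₁ ∧ ∀ z : Z, z ≠ x₁ → z ≠ ρ • x₁ → φ₁ • z = z)
    (hφ₂ : φ₂ • x₂ = ρ • x₂ ∧ ∀ z : Z, z ≠ x₂ → z ≠ ρ • x₂ → φ₂ • z = z)
    (hφ₃ : φ₃ • x₃ = ρ • x₃ ∧ ∀ z : Z, z ≠ x₃ → z ≠ ρ • x₃ → φ₃ • z = z)
    (ht : t • x₁ = x₂ ∧ t • x₂ = x₁ ∧ t • x₃ = x₃)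
    (hqM : ∀ (g : G) (y : Y), qM (g • y) = g • qM y) (hqMρ : ∀ y : Y, qM (ρ • y) = qM y)
    (hqMs : Function.Surjective qM) (x : X) :
    ∃ k : ℕ, k < 4 ∧ x = (t * φ₂) ^ k • qM y₀ := by
  obtain ⟨y, rfl⟩ := hqMs x
  obtain ⟨c1, -, -⟩ := twist_smul_cube hΦ hT hTi hT₀ hY hx h12 h13 h23 hφ₁ hφ₂ hφ₃ ht
  obtain ⟨c2, c3⟩ := twist_pow_smul_cube hΦ hT hTi hT₀ hY hx h12 h13 h23 hφ₁ hφ₂ hφ₃ ht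
  have e₁ : φ₁ • y₀ = ρ • φ₂ • φ₃ • y₀ := by
    rw [← rho_smul_pairFlip_smul hΦ hT hTi hx h12 h13 h23 hφ₁ hφ₂ hφ₃ y₀, rho_smul_rho_smul hΦ hT hTi]
  have k0 : qM y₀ = (t * φ₂) ^ 0 • qM y₀ := by rw [pow_zero, one_smul]
  have k1 : qM (φ₂ • φ₃ • y₀) = (t * φ₂) ^ 1 • qM y₀ := by rw [pow_one, ← hqM, c1, e₁, hqMρ]
  have k2 : qM (φ₃ • y₀) = (t * φ₂) ^ 2 • qM y₀ := by rw [← hqM, c2, hqMρ]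
  have k3 : qM (φ₂ • y₀) = (t * φ₂) ^ 3 • qM y₀ := by rw [← hqM, c3]
  rcases eq_or_eq_of_cube hΦ hT hTi hT₀ hY hx h12 h13 h23 hφ₂ hφ₃ y with (h | h | h | h) | (h | h | h | h) <;>
    rw [h]
  · exact ⟨0, by norm_num, k0⟩
  · exact ⟨3, by norm_num, k3⟩
  · exact ⟨2, by norm_num, k2⟩
  · exact ⟨1, by norm_num, k1⟩
  · exact ⟨0, by norm_num, by rw [hqMρ, ← k0]⟩
  · exact ⟨3, by norm_num, by rw [hqMρ, k3]⟩
  · exact ⟨2, by norm_num, by rw [hqMρ, k2]⟩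
  · exact ⟨1, by norm_num, by rw [hqMρ, k1]⟩

/-- **(A′) The twin slot is swept out by `g₄` and `ρ`**: every `y' ∈ Y'` is `g₄^k y₁'` or `ρ g₄^k y₁'` (`k < 4`)
for any base point `y₁'` over `qM(y₀)`. [cite: Dodson1984, §5.1.2] -/
theorem exists_pow_smul_of_twin [Fintype Y] (hΦ : IsCMTypeWith ρ Φ₀)
    (hT : ∀ (g : G) (y : Y) (x : Z), x ∈ T (g • y) ↔ g⁻¹ • x ∈ T y) (hTi : Function.Injective T)
    (hT₀ : T y₀ = Φ₀) (hY : ∀ y : Y, ∃ g : G, g • y₀ = y) (hx : Φ₀ = {x₁, x₂, x₃}) (h12 : x₁ ≠ x₂)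
    (h13 : x₁ ≠ x₃) (h23 : x₂ ≠ x₃)
    (hφ₁ : φ₁ • x₁ = ρ • x₁ ∧ ∀ z : Z, z ≠ x₁ → z ≠ ρ • x₁ → φ₁ • z = z)
    (hφ₂ : φ₂ • x₂ = ρ • x₂ ∧ ∀ z : Z, z ≠ x₂ → z ≠ ρ • x₂ → φ₂ • z = z)
    (hφ₃ : φ₃ • x₃ = ρ • x₃ ∧ ∀ z : Z, z ≠ x₃ → z ≠ ρ • x₃ → φ₃ • z = z)
    (ht : t • x₁ = x₂ ∧ t • x₂ = x₁ ∧ t • x₃ = x₃)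
    (hqM : ∀ (g : G) (y : Y), qM (g • y) = g • qM y) (hqMρ : ∀ y : Y, qM (ρ • y) = qM y)
    (hqMs : Function.Surjective qM) (hπM : ∀ (g : G) (y' : Y'), πM (g • y') = g • πM y')
    (hfib : ∀ y' y'' : Y', πM y' = πM y'' → y'' = y' ∨ y'' = ρ • y') {y₁' : Y'} (hy₁' : πM y₁' = qM y₀)
    (y' : Y') : ∃ k : ℕ, k < 4 ∧ (y' = (t * φ₂) ^ k • y₁' ∨ y' = ρ • (t * φ₂) ^ k • y₁') := by
  obtain ⟨k, hk, hx'⟩ := exists_pow_qM_eq hΦ hT hTi hT₀ hY hx h12 h13 h23 hφ₁ hφ₂ hφ₃ ht hqM hqMρ hqMs (πM y')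
  refine ⟨k, hk, hfib _ _ ?_⟩
  rw [hπM, hy₁', ← hx']

/-- **(B) `h = tφ₃` FIXES the points of the twin slot over `qM(φ₂y₀)`** (`h` fixes that diagonal and acts trivially
on `X_k`). [cite: Dodson1984, §5.1.2] -/
theorem smul_eq_self_of_twin [MulAction.IsPretransitive G Z] (hΦ : IsCMTypeWith ρ Φ₀)
    (hT : ∀ (g : G) (y : Y) (x : Z), x ∈ T (g • y) ↔ g⁻¹ • x ∈ T y) (hTi : Function.Injective T)
    (hT₀ : T y₀ = Φ₀) (hY : ∀ y : Y, ∃ g : G, g • y₀ = y) (hx : Φ₀ = {x₁, x₂, x₃}) (h12 : x₁ ≠ x₂)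
    (h13 : x₁ ≠ x₃) (h23 : x₂ ≠ x₃)
    (hφ₁ : φ₁ • x₁ = ρ • x₁ ∧ ∀ z : Z, z ≠ x₁ → z ≠ ρ • x₁ → φ₁ • z = z)
    (hφ₂ : φ₂ • x₂ = ρ • x₂ ∧ ∀ z : Z, z ≠ x₂ → z ≠ ρ • x₂ → φ₂ • z = z)
    (hφ₃ : φ₃ • x₃ = ρ • x₃ ∧ ∀ z : Z, z ≠ x₃ → z ≠ ρ • x₃ → φ₃ • z = z)
    (ht : t • x₁ = x₂ ∧ t • x₂ = x₁ ∧ t • x₃ = x₃)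
    (hqM : ∀ (g : G) (y : Y), qM (g • y) = g • qM y) (hqMρ : ∀ y : Y, qM (ρ • y) = qM y)
    (hπM : ∀ (g : G) (y' : Y'), πM (g • y') = g • πM y') (hπk : ∀ (g : G) (y' : Y'), πk (g • y') = g • πk y')
    (hfib : ∀ y' y'' : Y', πM y' = πM y'' → y'' = y' ∨ y'' = ρ • y')
    (hfac : ∀ g g' : G, (∀ z : Z, g • z = g' • z) → ∀ κ : Xk, g • κ = g' • κ)
    (hXk : ∀ κ : Xk, κ = κ₀ ∨ κ = ρ • κ₀) (hκ : ρ • κ₀ ≠ κ₀) (htκ : t • κ₀ ≠ κ₀)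
    {y₂' : Y'} (hy₂' : πM y₂' = qM (φ₂ • y₀)) : (t * φ₃) • y₂' = y₂' := by
  obtain ⟨-, -, c3⟩ := twist_smul_cube hΦ hT hTi hT₀ hY hx h12 h13 h23 hφ₁ hφ₂ hφ₃ ht
  obtain ⟨-, hh⟩ := twist_smul_base_eq hΦ hfac hXk hκ hx h12 h13 h23 hφ₁ hφ₂ hφ₃ htκ
  have hsame : πM ((t * φ₃) • y₂') = πM y₂' := by rw [hπM, hy₂', ← hqM, c3, hqMρ]
  rcases hfib _ _ hsame.symm with h | h
  · exact h
  · -- `ρ y₂'` has the other `k`-sign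
    exfalso
    have hk := congrArg πk h
    rw [hπk, hπk] at hk
    -- `(tφ₃)κ = κ` for both points of `X_k`, but `ρκ ≠ κ`
    have htriv : ∀ κ : Xk, (t * φ₃) • κ = κ := by
      intro κ
      rcases hXk κ with rfl | rfl
      · exact hh
      · rw [(rho_smul_base hΦ hfac (t * φ₃)).2, hh]
    rw [htriv] at hk
    rcases hXk (πk y₂') with h' | h'
    · rw [h'] at hk; exact hκ hk.symm
    · rw [h', (rho_smul_base hΦ hfac ρ).1] at hk; exact hκ hk

end Cube

/-! ### §3 The core lemma -/

/-- **An odd weight on the twin slot invariant under `g₄ = tφ₂` and anti-invariant under `h = tφ₃` vanishes.**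
By (A′) it is `±c` everywhere, `c` its value at a base point; by (B) it vanishes at a fixed point of `h`.
[cite: Dodson1984, §5.1.2 and Prop. 5.2.2] -/
theorem eq_zero_of_odd_of_twin [Fintype Y] [MulAction.IsPretransitive G Z] (hΦ : IsCMTypeWith ρ Φ₀)
    (hT : ∀ (g : G) (y : Y) (x : Z), x ∈ T (g • y) ↔ g⁻¹ • x ∈ T y) (hTi : Function.Injective T)
    (hT₀ : T y₀ = Φ₀) (hY : ∀ y : Y, ∃ g : G, g • y₀ = y) (hx : Φ₀ = {x₁, x₂, x₃}) (h12 : x₁ ≠ x₂)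
    (h13 : x₁ ≠ x₃) (h23 : x₂ ≠ x₃)
    (hφ₁ : φ₁ • x₁ = ρ • x₁ ∧ ∀ z : Z, z ≠ x₁ → z ≠ ρ • x₁ → φ₁ • z = z)
    (hφ₂ : φ₂ • x₂ = ρ • x₂ ∧ ∀ z : Z, z ≠ x₂ → z ≠ ρ • x₂ → φ₂ • z = z)
    (hφ₃ : φ₃ • x₃ = ρ • x₃ ∧ ∀ z : Z, z ≠ x₃ → z ≠ ρ • x₃ → φ₃ • z = z)
    (ht : t • x₁ = x₂ ∧ t • x₂ = x₁ ∧ t • x₃ = x₃)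
    (hqM : ∀ (g : G) (y : Y), qM (g • y) = g • qM y) (hqMρ : ∀ y : Y, qM (ρ • y) = qM y)
    (hqMs : Function.Surjective qM) (hπM : ∀ (g : G) (y' : Y'), πM (g • y') = g • πM y')
    (hπMs : Function.Surjective πM) (hπk : ∀ (g : G) (y' : Y'), πk (g • y') = g • πk y')
    (hfib : ∀ y' y'' : Y', πM y' = πM y'' → y'' = y' ∨ y'' = ρ • y')
    (hfac : ∀ g g' : G, (∀ z : Z, g • z = g' • z) → ∀ κ : Xk, g • κ = g' • κ)
    (hXk : ∀ κ : Xk, κ = κ₀ ∨ κ = ρ • κ₀) (hκ : ρ • κ₀ ≠ κ₀) (htκ : t • κ₀ ≠ κ₀)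
    {f : Y' → ℚ} (hodd : ∀ y', f (ρ • y') = -f y') (h4 : ∀ y', f ((t * φ₂) • y') = f y')
    (hh : ∀ y', f ((t * φ₃) • y') = -f y') : f = 0 := by
  obtain ⟨y₁', hy₁'⟩ := hπMs (qM y₀)
  obtain ⟨y₂', hy₂'⟩ := hπMs (qM (φ₂ • y₀))
  -- `f` is constant on the `g₄`-orbit of `y₁'`
  have hpow : ∀ k : ℕ, f ((t * φ₂) ^ k • y₁') = f y₁' := by
    intro k
    induction k with
    | zero => rw [pow_zero, one_smul]
    | succ k ih => rw [pow_succ', mul_smul, h4, ih]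
  -- `f(y₂') = 0` at the fixed point of `h`
  have h2 : f y₂' = 0 := by
    have h1 := hh y₂'
    rw [smul_eq_self_of_twin hΦ hT hTi hT₀ hY hx h12 h13 h23 hφ₁ hφ₂ hφ₃ ht hqM hqMρ hπM hπk hfib hfac hXk hκ
      htκ hy₂'] at h1
    linarith
  -- hence the constant is `0`
  have hc : f y₁' = 0 := by
    obtain ⟨k, -, hk | hk⟩ := exists_pow_smul_of_twin hΦ hT hTi hT₀ hY hx h12 h13 h23 hφ₁ hφ₂ hφ₃ ht hqM hqMρ
      hqMs hπM hfib hy₁' y₂'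
    · rw [← hpow k, ← hk, h2]
    · have := hodd ((t * φ₂) ^ k • y₁')
      rw [← hk, h2, hpow] at this
      linarith
  funext y'
  obtain ⟨k, -, hk | hk⟩ := exists_pow_smul_of_twin hΦ hT hTi hT₀ hY hx h12 h13 h23 hφ₁ hφ₂ hφ₃ ht hqM hqMρ
    hqMs hπM hfib hy₁' y'
  · rw [hk, hpow, hc, Pi.zero_apply]
  · rw [hk, hodd, hpow, hc, neg_zero, Pi.zero_apply]

end ReflexSlot

end Literature.NumberTheory.ComplexMultiplication
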